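/-
Copyright (c) 2026 the pub-hodgecm-mathlib formalisation cell (harness21).  Prover seat hodgecm-mathlib-K2Liu-p09 (g9), Track B «K2-LIT» ∕ hLiu418
#184♮, #42S BLOCK D row D-2, (σ-A) brick (b′)∕(α′) «the Cayley mover's Levi image» (road desk K2Liu-p25 (g3) WORDS #21, #24), 2026-09-05.  THEOREMS ONLY.
-/
import Literature.NumberTheory.GelbartRogawski1991.LocalDoubledWeylElementCayleyMover   -- ★ the Cayley mover: `ℓ_Δ ↦ ℓ_Y`, `E″ ι(w_Δ) E″⁻¹ = J⁻¹ m(B′)`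
import Summits.HodgeConjecture.HodgeConjecture.Theorems.K2LiuSiegelLeviWeylAlgebra         -- ★ `isSiegelDelta_weylDelta_conj` (w_Δ m w_Δ ∈ P_Δ for Levi m)
import HarnessLib

/-!
# Crux `HLiu418`, #42S block D row D-2, (σ-A) brick (α′): THE CAYLEY BI-MOVER CONJUGATES EVERY SIEGEL-LEVI ELEMENT OF THE DOUBLED
# UNITARY GROUP INTO A STANDARD LEVI `transportSp (m(B))` — the ∃-form dictionary that discharges the implementer letters `hB`

Cell `hodgecm-mathlib`, crux item hLiu418 = `stmt-HodgeConjecture-24832`; squad K2 ∕ K2Liu; helper lane `--supports stmt-HodgeConjecture-24832 --as helper`,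
count-neutral.  THEOREMS ONLY (no `def`, no `instance`, no `notation`, no named-fact hypothesis, no `sorry`).

WHY.  The corner action words of [A1] (★ p864240 ∕ p864439 `K2LiuLocalSWCornerActionWords(YStage)`, ★ p864336 `K2LiuLocalSWCornerActionWordsZeta`) and Kudla's
Levi action through an implementer (★ (C3-a) `K2LiuBlockImplementerLeviAction`) take the implementer letters BY VALUE: `hW₁ : π(p₁) ι(w_Δ) π(p₁)⁻¹ = J_𝕋⁻¹ m(B₁)`
and, for every Siegel-Levi corner letter `p` (`φ(w₁′)`, `φ(u⁻(ζ))`, `w₁·φ(w₂)`), `hB : π(m) ι(p) π(m)⁻¹ = transportSp 𝕋 (m(B))`.  The Weyl letter is ∃-discharged in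
tree (★ GR91 `exists_mover_conj_iotaD_weylDelta` + ★ `MpPsi.proj_surjective` ∘ ★ `existsImplementer_localSchrodinger`); the Levi letters pin the MOVER CLASS: a mover
with only `ℓ_Δ ↦ ℓ_Y` lands a Siegel-Levi `p` in the Siegel PARABOLIC of `ℓ_Y`, a BI-mover (`ℓ_Δ ↦ ℓ_Y` and `ℓ_{Δ⁻} ↦ ℓ_X`) lands it in the standard Levi.  THIS FILE
proves, with NO coordinates and NO re∕im bookkeeping, that the transported Cayley mover `E″` of ★ `LocalDoubledWeylElementCayleyMover` is such a bi-mover and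
packages ONE mover for ALL letters:
* §1 (generic symplectic linear algebra over a field `K`, any invertible symmetric Gram `T`) **`exists_eq_transportSp_levi_of_apply`**: an element of weil-1's
  `Sp(W, β_T)`, `W = K^ι × K^ι`, that keeps `ℓ_Y = 0 × K^ι` and `ℓ_X = K^ι × 0` is `transportSp T (m(a))` for some `a ∈ GL_ι(K)` (its `X`-block; the `Y`-block is
  forced to be `T⁻¹ a⁻ᵀ T` by symplecticity, ★ `transportSp_levi`).
* §2 (plumbing on `Sp(𝕎^𝔻_v)`): `transportSp (m(a))` keeps `ℓ_Y`; `(transportSp J)⁻¹` carries `ℓ_Y` onto `ℓ_X`; maps of products.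
* §3 **`exists_cayleyMover_levi_package`**: for the local doubled datum `(F, E, c, n, T₀)` there is ONE `E″ ∈ Sp(𝕎^𝔻_v)` with (a) `ℓ_Δ.map E″ = ℓ_Y`, (b) `∃ B′,
  E″ ι(w_Δ) E″⁻¹ = (transportSp J)⁻¹ · transportSp (m(B′))`, (c) **for every `p` in the Siegel LEVI `M_Δ` (`blkB (matA p) = 0`, `blkC (matA p) = 0`):
  `∃ B, E″ ι(p) E″⁻¹ = transportSp (m(B))`** — (c) from (a), (b): `g = E″ι(p)E″⁻¹` keeps `ℓ_Y` (`ι(p) ℓ_Δ = ℓ_Δ` IS ★ `IsSiegelDelta`, ★ `isSiegelDelta_iff_blkC_eq_zero`)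
  and keeps `ℓ_X = (transportSp J)⁻¹ ℓ_Y = E″ ι(w_Δ) ℓ_Δ` because `ι(p) ι(w_Δ) ℓ_Δ = ι(w_Δ) ι(w_Δ p w_Δ) ℓ_Δ = ι(w_Δ) ℓ_Δ` (★ `isSiegelDelta_weylDelta_conj`), then §1.
The END assembler lifts `E″` to implementers `p₁, p₂` by ★ `MpPsi.proj_surjective` (pattern ★ `K2LiuLocalSWSpanningSplitFaceClosed` :180–:184) and `obtain`s `hp₁`,
`hW₁` AND every Levi `hB` from the same package.
HONEST LABEL.  Count-neutral helper: `HC_CM` is proved only modulo the 7 printed citations (2 remaining named inputs: hLiu418 = `stmt-HodgeConjecture-24832`,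
h413 = `stmt-HodgeConjecture-24833`) until rung 0 closes.

## References
* [Kudla1994] S. S. Kudla, *Splitting metaplectic covers of dual reductive pairs*, Israel J. Math. 87 (1994), §3 (the doubled space, `W^Δ`, `W^{Δ⁻}`, `P_Δ`, `M_Δ`).
* [MoeglinVignerasWaldspurger1987] C. Mœglin, M.-F. Vignéras, J.-L. Waldspurger, LNM 1291 (1987), Chap. 2 II.2 (Siegel parabolic and Levi of a polarisation).
* [Weil1964] A. Weil, *Sur certains groupes d'opérateurs unitaires*, Acta Math. 111 (1964), n° 5–6 (the elements `m(a, d)` of `Sp(W)`).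
* [HarrisKudlaSweet1996] M. Harris, S. Kudla, W. J. Sweet, J. AMS 9 (1996), §1 (1.10)–(1.12), (1.15).
-/

set_option autoImplicit false
-- the mandated namespace repeats the single-problem summit's segment (`HodgeConjecture.HodgeConjecture`)
set_option linter.dupNamespace false

noncomputable section

open NumberField IsDedekindDomain Matrix
open Literature.RepresentationTheory.HeisenbergGroup Literature.RepresentationTheory.HeisenbergGroup.SymplecticMatrix
open Literature.NumberTheory.Automorphic Literature.NumberTheory.Automorphic.UnitaryGroup
open Literature.NumberTheory.GelbartRogawski1991.AdaptedBlocks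
open Literature.NumberTheory.GelbartRogawski1991.UnitaryDualPair.LocalSplitting
open Summit.HodgeConjecture.HodgeConjecture.Cruxes.HLiu418.K2LiuSiegelLeviWeylAlgebra (isSiegelDelta_weylDelta_conj)

namespace Summit.HodgeConjecture.HodgeConjecture.Cruxes.HLiu418.K2LiuLocalCayleyMoverLeviImage

/-! ## §1 An element of `Sp(W, β_T)` keeping `ℓ_X` and `ℓ_Y` is a standard Levi `transportSp T (m(a))` -/

section Generic

variable {K : Type*} [Field K] {ι : Type*} [Fintype ι] [DecidableEq ι] (T : Matrix ι ι K) (hT : IsUnit T.det)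

/-- **an isometry of `(K^ι × K^ι, β_T)` that keeps `ℓ_Y = 0 × K^ι` and `ℓ_X = K^ι × 0` is `transportSp T (m(a))`**, `a` its `X`-block (the `Y`-block is then
`T⁻¹ a⁻ᵀ T`: `β_T(a x, d y) = β_T(x, y)` forces `aᵀ T d = T`). [cite: Weil1964, n° 6, p. 151] [cite: MoeglinVignerasWaldspurger1987, Chap. 2 II.2] -/
theorem exists_eq_transportSp_levi_of_apply (g : symplecticGroup (polar (Matrix.toLinearMap₂' K T)))
    (hY : ∀ y : ι → K, ((g : ((ι → K) × (ι → K)) ≃ₗ[K] ((ι → K) × (ι → K))) (0, y)).1 = 0)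
    (hX : ∀ x : ι → K, ((g : ((ι → K) × (ι → K)) ≃ₗ[K] ((ι → K) × (ι → K))) (x, 0)).2 = 0) :
    ∃ a : GL ι K, g = transportSp T hT (levi a) := by
  -- the `X`-block `x ↦ (g (x, 0)).1` is an injective endomorphism of `K^ι`, hence invertible
  obtain ⟨G, hG⟩ : ∃ G : ((ι → K) × (ι → K)) ≃ₗ[K] ((ι → K) × (ι → K)), G = g := ⟨_, rfl⟩
  obtain ⟨aL, haL⟩ : ∃ aL : (ι → K) →ₗ[K] (ι → K), ∀ x, aL x = (G (x, 0)).1 :=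
    ⟨(LinearMap.fst K _ _).comp ((G : ((ι → K) × (ι → K)) →ₗ[K] ((ι → K) × (ι → K))).comp (LinearMap.inl K _ _)), fun _ => rfl⟩
  obtain ⟨dL, hdL⟩ : ∃ dL : (ι → K) →ₗ[K] (ι → K), ∀ y, dL y = (G (0, y)).2 :=
    ⟨(LinearMap.snd K _ _).comp ((G : ((ι → K) × (ι → K)) →ₗ[K] ((ι → K) × (ι → K))).comp (LinearMap.inr K _ _)), fun _ => rfl⟩
  have hGx : ∀ x, G (x, 0) = (aL x, 0) := fun x => Prod.ext (haL x).symm (hG ▸ hX x)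
  have hGy : ∀ y, G (0, y) = (0, dL y) := fun y => Prod.ext (hG ▸ hY y) (hdL y).symm
  have hinj : Function.Injective aL := by
    intro x x' h
    have h2 : G (x, 0) = G (x', 0) := by rw [hGx, hGx, h]
    exact (Prod.mk.inj (G.injective h2)).1
  obtain ⟨a, ha⟩ : ∃ a : GL ι K, ∀ x, (a : Matrix ι ι K) *ᵥ x = aL x := by
    let aE := LinearEquiv.ofInjectiveEndo aL hinj
    have h1 : LinearMap.toMatrix' (aE : (ι → K) →ₗ[K] (ι → K)) * LinearMap.toMatrix' (aE.symm : (ι → K) →ₗ[K] (ι → K)) = 1 := by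
      rw [← LinearMap.toMatrix'_mul, show (aE : (ι → K) →ₗ[K] (ι → K)) * (aE.symm : (ι → K) →ₗ[K] (ι → K)) = LinearMap.id from
        LinearMap.ext fun x => aE.apply_symm_apply x, LinearMap.toMatrix'_id]
    have h2 : LinearMap.toMatrix' (aE.symm : (ι → K) →ₗ[K] (ι → K)) * LinearMap.toMatrix' (aE : (ι → K) →ₗ[K] (ι → K)) = 1 := by
      rw [← LinearMap.toMatrix'_mul, show (aE.symm : (ι → K) →ₗ[K] (ι → K)) * (aE : (ι → K) →ₗ[K] (ι → K)) = LinearMap.id from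
        LinearMap.ext fun x => aE.symm_apply_apply x, LinearMap.toMatrix'_id]
    refine ⟨⟨_, _, h1, h2⟩, fun x => ?_⟩
    change LinearMap.toMatrix' (aE : (ι → K) →ₗ[K] (ι → K)) *ᵥ x = aL x
    rw [← Matrix.toLin'_apply, Matrix.toLin'_toMatrix']
    rfl
  -- symplecticity forces the `Y`-block: `aᵀ T (d y) = T y`
  have hsymp := (mem_symplecticGroup (polar (Matrix.toLinearMap₂' K T)) G).1 (hG ▸ g.2)
  have hd : ∀ y, dL y = (T⁻¹ * ((a⁻¹ : GL ι K) : Matrix ι ι K)ᵀ * T) *ᵥ y := by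
    intro y
    have key : ∀ x, x ⬝ᵥ ((a : Matrix ι ι K)ᵀ *ᵥ (T *ᵥ dL y)) = x ⬝ᵥ (T *ᵥ y) := by
      intro x
      have h := hsymp (x, 0) (0, y)
      rw [hGx, hGy] at h
      simp only [polar_apply, Matrix.toLinearMap₂'_apply', Matrix.mulVec_zero, dotProduct_zero, sub_zero] at h
      rw [← ha x, ← vecMul_transpose, ← dotProduct_mulVec] at h
      exact h
    have hvec : (a : Matrix ι ι K)ᵀ *ᵥ (T *ᵥ dL y) = T *ᵥ y := by
      funext i
      have h := key (Pi.single i 1)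
      rwa [single_dotProduct, single_dotProduct, one_mul, one_mul] at h
    have hTd : T *ᵥ dL y = ((a⁻¹ : GL ι K) : Matrix ι ι K)ᵀ *ᵥ (T *ᵥ y) := by
      rw [← hvec, Matrix.mulVec_mulVec, transpose_inv_mul_transpose, Matrix.one_mulVec]
    calc dL y = T⁻¹ *ᵥ (T *ᵥ dL y) := by rw [Matrix.mulVec_mulVec, Matrix.nonsing_inv_mul T hT, Matrix.one_mulVec]
      _ = (T⁻¹ * ((a⁻¹ : GL ι K) : Matrix ι ι K)ᵀ * T) *ᵥ y := by rw [hTd, Matrix.mulVec_mulVec, Matrix.mulVec_mulVec, Matrix.mul_assoc]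
  -- assemble
  refine ⟨a, Subtype.ext ?_⟩
  rw [← hG, transportSp_levi]
  refine LinearEquiv.ext fun w => ?_
  obtain ⟨x, y⟩ := w
  have hsplit : G (x, y) = G (x, 0) + G (0, y) := by rw [← map_add, Prod.mk_add_mk, add_zero, zero_add]
  rw [coe_leviSp_apply, glEquiv_apply, leviDual_apply, hsplit, hGx, hGy, Prod.mk_add_mk, add_zero, zero_add, ha, hd]

end Generic

/-! ## §2 Plumbing on `Sp(𝕎_v)`: maps of products, the Levi keeps `ℓ_Y`, the Weyl element `J` swaps `ℓ_X` and `ℓ_Y` -/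

section Local

variable (F : Type) [Field F] [NumberField F] (v : HeightOneSpectrum (𝓞 F)) {N : ℕ} {T : Matrix (Fin N) (Fin N) F}

/-- the linear map of a product is the composite of the linear maps. [folklore] -/
theorem toLin_mul (a b : LocalSp F N T v) : toLin F v (a * b) = (toLin F v a).comp (toLin F v b) := rfl

/-- `(S.map g).map g′ = S.map (g′ g)`. [folklore] -/
theorem map_map_toLin (a b : LocalSp F N T v)
    (S : Submodule (v.adicCompletion F) ((Fin N → v.adicCompletion F) × (Fin N → v.adicCompletion F))) :
    (S.map (toLin F v b)).map (toLin F v a) = S.map (toLin F v (a * b)) := by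
  rw [toLin_mul, Submodule.map_comp]

/-- if `P S = S′` then `P⁻¹ S′ = S` (★ `map_deltaLagrangian_inv_of_map_eq`'s idiom for any pair of submodules). [folklore] -/
theorem map_toLin_inv_of_map_eq (P : LocalSp F N T v)
    {S S' : Submodule (v.adicCompletion F) ((Fin N → v.adicCompletion F) × (Fin N → v.adicCompletion F))}
    (hP : S.map (toLin F v P) = S') : S'.map (toLin F v P⁻¹) = S := by
  rw [← hP, map_map_toLin, inv_mul_cancel]
  exact Submodule.map_id S

/-- **the standard Levi `transportSp 𝕋 (m(a))` keeps `ℓ_Y = 0 × F_vᴺ`** (`(x, y) ↦ (a x, 𝕋⁻¹ a⁻ᵀ 𝕋 y)`, ★ `transportSp_levi`). [cite: MoeglinVignerasWaldspurger1987, Chap. 2 II.2] -/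
theorem map_lagrangianY_transportSp_levi (hTv : IsUnit (localGram F N T v).det) (a : GL (Fin N) (v.adicCompletion F)) :
    (lagrangianY F N v).map (toLin F v (transportSp (localGram F N T v) hTv (levi a))) = lagrangianY F N v := by
  refine le_antisymm ?_ ?_
  · rintro w ⟨⟨x, y⟩, hxy, rfl⟩
    rw [lagrangianY, SetLike.mem_coe, Submodule.mem_prod, Submodule.mem_bot] at hxy
    obtain ⟨rfl, -⟩ := hxy
    refine Submodule.mem_prod.2 ⟨(Submodule.mem_bot _).2 ?_, Submodule.mem_top⟩
    change (((transportSp (localGram F N T v) hTv (levi a) : LocalSp F N T v) :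
      ((Fin N → v.adicCompletion F) × (Fin N → v.adicCompletion F)) ≃ₗ[v.adicCompletion F]
        ((Fin N → v.adicCompletion F) × (Fin N → v.adicCompletion F))) (0, y)).1 = 0
    rw [transportSp_levi, coe_leviSp_apply, glEquiv_apply, Matrix.mulVec_zero]
  · rintro ⟨x, y⟩ hxy
    rw [lagrangianY, Submodule.mem_prod, Submodule.mem_bot] at hxy
    obtain ⟨rfl, -⟩ := hxy
    refine ⟨(0, (leviDual (localGram F N T v) hTv a).symm y), Submodule.mem_prod.2 ⟨(Submodule.mem_bot _).2 rfl, Submodule.mem_top⟩, ?_⟩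
    change ((transportSp (localGram F N T v) hTv (levi a) : LocalSp F N T v) :
      ((Fin N → v.adicCompletion F) × (Fin N → v.adicCompletion F)) ≃ₗ[v.adicCompletion F]
        ((Fin N → v.adicCompletion F) × (Fin N → v.adicCompletion F))) (0, (leviDual (localGram F N T v) hTv a).symm y) = (0, y)
    rw [transportSp_levi, coe_leviSp_apply, glEquiv_apply, Matrix.mulVec_zero, LinearEquiv.apply_symm_apply]

/-- **the Weyl element `transportSp 𝕋 J` carries `ℓ_X = F_vᴺ × 0` onto `ℓ_Y`** (`(x, y) ↦ (−𝕋 y, 𝕋⁻¹ x)`, ★ `transportSp_J`). [cite: MoeglinVignerasWaldspurger1987, Chap. 2 II.2] -/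
theorem map_prod_top_bot_transportSp_symJ (hTv : IsUnit (localGram F N T v).det) :
    (Submodule.prod ⊤ ⊥ : Submodule (v.adicCompletion F) ((Fin N → v.adicCompletion F) × (Fin N → v.adicCompletion F))).map
        (toLin F v (transportSp (localGram F N T v) hTv (SymplecticGroup.symJ (Fin N) (v.adicCompletion F)))) =
      lagrangianY F N v := by
  refine le_antisymm ?_ ?_
  · rintro w ⟨⟨x, y⟩, hxy, rfl⟩
    rw [SetLike.mem_coe, Submodule.mem_prod, Submodule.mem_bot] at hxy
    obtain ⟨-, rfl⟩ := hxy
    refine Submodule.mem_prod.2 ⟨(Submodule.mem_bot _).2 ?_, Submodule.mem_top⟩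
    change (((transportSp (localGram F N T v) hTv (SymplecticGroup.symJ (Fin N) (v.adicCompletion F)) : LocalSp F N T v) :
      ((Fin N → v.adicCompletion F) × (Fin N → v.adicCompletion F)) ≃ₗ[v.adicCompletion F]
        ((Fin N → v.adicCompletion F) × (Fin N → v.adicCompletion F))) (x, 0)).1 = 0
    rw [transportSp_J, coe_weylSp, weylσ_apply, weylGamma_apply, Matrix.mulVec_zero, neg_zero]
  · rintro ⟨x, y⟩ hxy
    rw [lagrangianY, Submodule.mem_prod, Submodule.mem_bot] at hxy
    obtain ⟨rfl, -⟩ := hxy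
    refine ⟨(localGram F N T v *ᵥ y, 0), Submodule.mem_prod.2 ⟨Submodule.mem_top, (Submodule.mem_bot _).2 rfl⟩, ?_⟩
    change ((transportSp (localGram F N T v) hTv (SymplecticGroup.symJ (Fin N) (v.adicCompletion F)) : LocalSp F N T v) :
      ((Fin N → v.adicCompletion F) × (Fin N → v.adicCompletion F)) ≃ₗ[v.adicCompletion F]
        ((Fin N → v.adicCompletion F) × (Fin N → v.adicCompletion F))) (localGram F N T v *ᵥ y, 0) = (0, y)
    rw [transportSp_J, coe_weylSp, weylσ_apply, weylGamma_apply, gramEquiv_symm_apply, Matrix.mulVec_zero, neg_zero, Matrix.mulVec_mulVec,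
      Matrix.nonsing_inv_mul _ hTv, Matrix.one_mulVec]

end Local

/-! ## §3 The Cayley bi-mover: ONE mover for the Weyl letter and every Siegel-Levi letter -/

section Doubled

variable (F : Type) [Field F] [NumberField F] (E : Type) [Field E] [NumberField E] [Algebra F E]
  [Algebra.IsQuadraticExtension F E] (c : E ≃ₐ[F] E)
  {δ : E} (hcδ : c δ = -δ) (hδ : δ ≠ 0) {d : F} (hd : δ * δ = algebraMap F E d)
  (v : HeightOneSpectrum (𝓞 F)) (n : ℕ) {T₀ : Matrix (Fin n) (Fin n) F} (hT₀ : T₀.IsSymm) (hT₀d : IsUnit T₀.det)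
  {JD : Matrix (Fin (n + n)) (Fin (n + n)) E} (hJD : JD = (gramD F n T₀).map (algebraMap F E))

set_option maxHeartbeats 400000 in
/-- **THE LEVI IMAGE OF A BI-MOVER.**  If `E″ ∈ Sp(𝕎^𝔻_v)` carries `ℓ_Δ` onto `ℓ_Y` and conjugates `ι(w_Δ)` to `(transportSp J)⁻¹ · transportSp (m(B′))`, then for every
`p` in the Siegel LEVI `M_Δ` (`blkB (matA p) = 0`, `blkC (matA p) = 0`) **`E″ · ι(p) · E″⁻¹ = transportSp 𝕋 (m(B))` for some `B ∈ GL_{n+n}(F_v)`**: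
`g = E″ι(p)E″⁻¹` keeps `ℓ_Y` (`ι(p) ℓ_Δ = ℓ_Δ` is ★ `IsSiegelDelta`) and keeps `ℓ_X = (transportSp J)⁻¹ ℓ_Y = E″ ι(w_Δ) ℓ_Δ` (`ι(p) ι(w_Δ) ℓ_Δ = ι(w_Δ) ι(w_Δ p w_Δ) ℓ_Δ`,
★ `isSiegelDelta_weylDelta_conj`), then §1. [cite: Kudla1994, §3] [cite: MoeglinVignerasWaldspurger1987, Chap. 2 II.2] -/
theorem exists_conj_iotaD_eq_transportSp_levi (hTv : IsUnit (localGram F (n + n) (gramD F n T₀) v).det)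
    (E'' : LocalSp F (n + n) (gramD F n T₀) v) (hE : (deltaLagrangian F v n).map (toLin F v E'') = lagrangianY F (n + n) v)
    {B' : GL (Fin (n + n)) (v.adicCompletion F)}
    (hW : E'' * iotaD F E c hcδ hδ hd v n hT₀ hJD (weylDelta F E c v n hJD) * E''⁻¹ =
      (transportSp (localGram F (n + n) (gramD F n T₀) v) hTv (SymplecticGroup.symJ _ _))⁻¹ *
        transportSp (localGram F (n + n) (gramD F n T₀) v) hTv (levi B'))
    {p : UnitaryGroup.localPi E c (n + n) JD v} (hB : blkB (matA F E c v n p) = 0) (hC : blkC (matA F E c v n p) = 0) :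
    ∃ B : GL (Fin (n + n)) (v.adicCompletion F),
      E'' * iotaD F E c hcδ hδ hd v n hT₀ hJD p * E''⁻¹ = transportSp (localGram F (n + n) (gramD F n T₀) v) hTv (levi B) := by
  have hpΔ : IsSiegelDelta F E c hcδ hδ hd v n hT₀ hJD p := (isSiegelDelta_iff_blkC_eq_zero F E c hcδ hδ hd v n hT₀ hJD p).2 hC
  have hqΔ := isSiegelDelta_weylDelta_conj F E c hcδ hδ hd v n hT₀ hJD hC hB
  rw [IsSiegelDelta] at hpΔ hqΔ
  -- `ℓ_X = E″ ι(w_Δ) ℓ_Δ`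
  have hX : (Submodule.prod ⊤ ⊥ : Submodule (v.adicCompletion F) ((Fin (n + n) → v.adicCompletion F) × (Fin (n + n) → v.adicCompletion F))) =
      (deltaLagrangian F v n).map (toLin F v (E'' * iotaD F E c hcδ hδ hd v n hT₀ hJD (weylDelta F E c v n hJD))) := by
    have h1 : E'' * iotaD F E c hcδ hδ hd v n hT₀ hJD (weylDelta F E c v n hJD) =
        (transportSp (localGram F (n + n) (gramD F n T₀) v) hTv (SymplecticGroup.symJ _ _))⁻¹ *
          transportSp (localGram F (n + n) (gramD F n T₀) v) hTv (levi B') * E'' := by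
      rw [← hW, inv_mul_cancel_right]
    rw [h1, ← map_map_toLin, ← map_map_toLin, hE, map_lagrangianY_transportSp_levi,
      map_toLin_inv_of_map_eq F v _ (map_prod_top_bot_transportSp_symJ F v hTv)]
  -- `g = E″ ι(p) E″⁻¹` keeps `ℓ_Y` and `ℓ_X`
  have hgY : (lagrangianY F (n + n) v).map (toLin F v (E'' * iotaD F E c hcδ hδ hd v n hT₀ hJD p * E''⁻¹)) = lagrangianY F (n + n) v := by
    rw [← map_map_toLin, ← map_map_toLin, map_toLin_inv_of_map_eq F v _ hE, hpΔ, hE]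
  have hgX : (Submodule.prod ⊤ ⊥ : Submodule (v.adicCompletion F) ((Fin (n + n) → v.adicCompletion F) × (Fin (n + n) → v.adicCompletion F))).map
      (toLin F v (E'' * iotaD F E c hcδ hδ hd v n hT₀ hJD p * E''⁻¹)) = Submodule.prod ⊤ ⊥ := by
    have hww := weylDelta_mul_self F E c v n hJD (T₀ := T₀)
    have h2 : E'' * iotaD F E c hcδ hδ hd v n hT₀ hJD p * E''⁻¹ * (E'' * iotaD F E c hcδ hδ hd v n hT₀ hJD (weylDelta F E c v n hJD)) =
        E'' * iotaD F E c hcδ hδ hd v n hT₀ hJD (weylDelta F E c v n hJD) *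
          iotaD F E c hcδ hδ hd v n hT₀ hJD (weylDelta F E c v n hJD * p * weylDelta F E c v n hJD) := by
      have hιww : iotaD F E c hcδ hδ hd v n hT₀ hJD (weylDelta F E c v n hJD) * iotaD F E c hcδ hδ hd v n hT₀ hJD (weylDelta F E c v n hJD) = 1 := by
        rw [← map_mul, hww, map_one]
      rw [map_mul, map_mul, ← mul_assoc (E'' * iotaD F E c hcδ hδ hd v n hT₀ hJD p * E''⁻¹), inv_mul_cancel_right]
      simp only [mul_assoc]
      rw [← mul_assoc (iotaD F E c hcδ hδ hd v n hT₀ hJD (weylDelta F E c v n hJD)) (iotaD F E c hcδ hδ hd v n hT₀ hJD (weylDelta F E c v n hJD)),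
        hιww, one_mul]
    conv_lhs => rw [hX, map_map_toLin, h2, ← map_map_toLin, hqΔ]
    rw [hX]
  -- read the two equalities pointwise and apply §1
  refine exists_eq_transportSp_levi_of_apply (localGram F (n + n) (gramD F n T₀) v) hTv _ (fun y => ?_) (fun x => ?_)
  · have hy : ((0 : Fin (n + n) → v.adicCompletion F), y) ∈ lagrangianY F (n + n) v :=
      Submodule.mem_prod.2 ⟨(Submodule.mem_bot _).2 rfl, Submodule.mem_top⟩
    have h := hgY.le (Submodule.mem_map_of_mem hy)
    rw [lagrangianY, Submodule.mem_prod, Submodule.mem_bot] at h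
    exact h.1
  · have hx : (x, (0 : Fin (n + n) → v.adicCompletion F)) ∈
        (Submodule.prod ⊤ ⊥ : Submodule (v.adicCompletion F) ((Fin (n + n) → v.adicCompletion F) × (Fin (n + n) → v.adicCompletion F))) :=
      Submodule.mem_prod.2 ⟨Submodule.mem_top, (Submodule.mem_bot _).2 rfl⟩
    have h := hgX.le (Submodule.mem_map_of_mem hx)
    rw [Submodule.mem_prod, Submodule.mem_bot] at h
    exact h.2

include hT₀d in
/-- **THE CAYLEY BI-MOVER PACKAGE: ONE MOVER FOR ALL IMPLEMENTER LETTERS.**  There is `E″ ∈ Sp(𝕎^𝔻_v)` — the transported Cayley mover of ★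
`LocalDoubledWeylElementCayleyMover` — with (a) `ℓ_Δ.map E″ = ℓ_Y` (the mover letter `hp`), (b) `E″ ι(w_Δ) E″⁻¹ = (transportSp J)⁻¹ · transportSp (m(B′))` (the Weyl
letter `hW`), and (c) **for every Siegel-LEVI `p` (`blkB (matA p) = 0 = blkC (matA p)`), `E″ ι(p) E″⁻¹ = transportSp (m(B))` for some `B`** (the Levi letters `hB` of
★ (C3-a) `K2LiuBlockImplementerLeviAction` ∕ ★ [A1-ζ] `K2LiuLocalSWCornerActionWordsZeta`).  Lift `E″` to an implementer by ★ `MpPsi.proj_surjective` ∘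
★ `existsImplementer_localSchrodinger`. [cite: Kudla1994, §3] [cite: MoeglinVignerasWaldspurger1987, Chap. 2 II.2] [cite: HarrisKudlaSweet1996, §1 (1.11), (1.15)] -/
theorem exists_cayleyMover_levi_package (hTv : IsUnit (localGram F (n + n) (gramD F n T₀) v).det) :
    ∃ E'' : LocalSp F (n + n) (gramD F n T₀) v,
      (deltaLagrangian F v n).map (toLin F v E'') = lagrangianY F (n + n) v ∧
      (∃ B' : GL (Fin (n + n)) (v.adicCompletion F),
        E'' * iotaD F E c hcδ hδ hd v n hT₀ hJD (weylDelta F E c v n hJD) * E''⁻¹ =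
          (transportSp (localGram F (n + n) (gramD F n T₀) v) hTv (SymplecticGroup.symJ _ _))⁻¹ *
            transportSp (localGram F (n + n) (gramD F n T₀) v) hTv (levi B')) ∧
      ∀ p : UnitaryGroup.localPi E c (n + n) JD v, blkB (matA F E c v n p) = 0 → blkC (matA F E c v n p) = 0 →
        ∃ B : GL (Fin (n + n)) (v.adicCompletion F),
          E'' * iotaD F E c hcδ hδ hd v n hT₀ hJD p * E''⁻¹ = transportSp (localGram F (n + n) (gramD F n T₀) v) hTv (levi B) := by
  obtain ⟨E'', B', hE, hW⟩ := exists_mover_conj_iotaD_weylDelta F E c hcδ hδ hd v n hT₀ hT₀d hJD hTv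
  exact ⟨E'', hE, ⟨B', hW⟩, fun p hB hC => exists_conj_iotaD_eq_transportSp_levi F E c hcδ hδ hd v n hT₀ hJD hTv E'' hE hW hB hC⟩

end Doubled

end Summit.HodgeConjecture.HodgeConjecture.Cruxes.HLiu418.K2LiuLocalCayleyMoverLeviImage

end
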